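import Summits.ResolutionOfSingularities.ResolutionOfSingularities.Theorems.EquisingularLiftEquisingularLiftNatInvStepSingular
import Summits.ResolutionOfSingularities.ResolutionOfSingularities.Theorems.EquisingularLiftEquisingularLiftNatCentredPackageTransport
import HarnessLib

/-!
# [OURS · L1 W4.5(b) · EL♮(3)] (ε)-CORE — the in-carrier step at a CENTRED point for a member with a GENERAL excluded set
# (HSUB′(ReachTC⁺⁺)₃ per-subset members; `TCPlus.Member` v3 …NatSubchainSupplierInvDefs p532383 verbatim)

Crux `EquisingularLiftNat` = stmt-ResolutionOfSingularities-20038 (child EL♮(3) = stmt-ResolutionOfSingularities-20148), route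
EquisingularLift, line `sections`. Helper file `--supports stmt-ResolutionOfSingularities-20148 --as helper` by res-L1-w45b-stub-1 g7
(author of (C) `inv_step_singular`, p543070). HONEST FRAMING: OURS (cell res-hironaka, slot W4.5(b)); NOT a statement of any manuscript;
AI-written, weaker than expert review. No `sorry`; standard axioms.

WHAT. `member_strictTransform_of_centredPoint_excl`: the Member-level centred step of …NatInvStepSingular
(`member_strictTransform_of_centredPoint`, excluded set `{x}` ↦ `∅`) for a member with ANY excluded set `excl ∋ x`: after the blow-up
of the package's section through `jG x` the pair `(St 𝓢, St K)` is a member with excluded set `υ⁻¹(excl ∖ {x})` — clause (v) now also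
skips the points over the other excluded points (they are exactly `j₂ '' υ⁻¹(excl ∖ {x})` by the model square), and clause (vi) there is
res-D-pv-029's package transport `centredPackage_strictTransform` (p541005; the other excluded points are off the section). This is the
singular step of a PER-SUBSET member of res-L1-w45b-stub-3's HSUB′(ReachTC⁺⁺)₃ invariant (INV″ = `∀ S ⊆ Cand, TCPlus.Member … S`,
res-L1-w45b-plan-1 WORD 2026-08-27T15:07:43Z (1)) at a point of its subset — object (ε) of the TC⁺⁺ board, Member level.

References: [cite: GortzWedhorn2020, Prop. 13.91, Prop. 13.96]; [cite: Liu2002, Thm. 8.1.19]. Tree inputs: p543070 (and through it p526229,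
p534965, p532002, p529806, p536122, p538787, p519966), p541005.
-/

set_option linter.dupNamespace false -- mandated namespace `Summit.<Summit>.<Problem>` of this single-conjunct summit
set_option linter.overlappingInstances false -- signatures carry `[IsDomain O] [IsDiscreteValuationRing O]`

noncomputable section

open CategoryTheory CategoryTheory.Limits AlgebraicGeometry TopologicalSpace Topology IsLocalRing
open Literature.AlgebraicGeometry.Resolution
open AlgebraicGeometry.Scheme.IdealSheafData
open Summit.ResolutionOfSingularities.ResolutionOfSingularities.Theses.EquisingularLift.Split
open Summit.ResolutionOfSingularities.ResolutionOfSingularities.Cruxes.EquisingularLift.StrataSplit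

namespace Summit.ResolutionOfSingularities.ResolutionOfSingularities.Cruxes.EquisingularLiftNat.Sections

/-- **The in-carrier step at a centred point, general excluded set (Member level).** As `member_strictTransform_of_centredPoint`
(…NatInvStepSingular), for a member `TCPlus.Member O k θ P q Y Ch G T Z excl` and a closed point `x ∈ excl ∩ T` (`T ⊄ {x}`, `G` integral)
and the blow-up `υ : G₂ → G` of the reduced point `x`: `G₂` is integral, `closure υ⁻¹(T ∖ {x})` is irreducible, and `(St 𝓢, St K)` on the
blow-up of the package's section is a member `TCPlus.Member O k θ P q Y Ch G₂ (closure υ⁻¹(T ∖ {x})) (closure υ⁻¹(Z ∖ {x})) (υ⁻¹(excl ∖ {x}))`.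
[cite: GortzWedhorn2020, Prop. 13.91, Prop. 13.96] [cite: Liu2002, Thm. 8.1.19] [OURS · L1 W4.5b] (ε)-core toward the TC⁺⁺ rung
(stmt-ResolutionOfSingularities-20148 / -20038); NOT a statement of the manuscript. -/
theorem member_strictTransform_of_centredPoint_excl (O : Type) [CommRing O] [IsDomain O] [IsDiscreteValuationRing O]
    (k : Type) [Field k] (θ : O →+* k) (hθ : Function.Surjective θ)
    (P : Scheme.{0}) [IsIntegral P] (q : P ⟶ Spec (.of O)) [IsProper q] [SmoothOfRelativeDimension 3 q]
    (Y : Set P) (hYsp : Y ⊆ q ⁻¹' {closedPoint O}) (hYirr : IsIrreducible Y) (hYcl : IsClosed Y)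
    (hPnoeth : IsLocallyNoetherian P) (hPreg : Scheme.IsRegular P)
    (Ch : ∀ X' : Scheme.{0}, (X' ⟶ P) → Set X' → Prop)
    (hChain : ∀ (X' : Scheme.{0}) (σ : X' ⟶ P) (S : Set X'), Ch X' σ S → Chain P Y X' σ S)
    (hStep : ∀ (X' X'' : Scheme.{0}) (σ' : X' ⟶ P) (S' : Set X') (C : X'.IdealSheafData) (τ : X'' ⟶ X'),
      Ch X' σ' S' → IsBlowup τ C → Scheme.IsRegular C.subscheme → Flat (C.subschemeι ≫ σ' ≫ q) →
      σ' '' (C.support : Set X') ⊆ {x : P | ¬ IsGenericPoint x Y} →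
      (C.support : Set X') ∩ (σ' ≫ q) ⁻¹' {closedPoint O} ⊆ S' →
      Ch X'' (τ ≫ σ') (closure (τ ⁻¹' (S' \ (C.support : Set X')))))
    (G : Scheme.{0}) [IsIntegral G] (T Z excl : Set G) (x : G) (hx : IsClosed ({x} : Set G)) (hxT : x ∈ T)
    (hTx : ¬ T ⊆ {x}) (hxexcl : x ∈ excl) (hmem : TCPlus.Member O k θ P q Y Ch G T Z excl)
    (G₂ : Scheme.{0}) (υ : G₂ ⟶ G) (hυ : IsBlowup υ (vanishingIdeal ⟨{x}, hx⟩)) :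
    IsIntegral G₂ ∧ IsIrreducible (closure (υ ⁻¹' (T \ {x}))) ∧
      TCPlus.Member O k θ P q Y Ch G₂ (closure (υ ⁻¹' (T \ {x}))) (closure (υ ⁻¹' (Z \ {x}))) (υ ⁻¹' (excl \ {x})) := by
  classical
  obtain ⟨X, σ, S, j, t, 𝓢, K, hCh, hXint, hXnoeth, hXreg, hdom, hsq, hTS, hi, hii, hiii₁, hiii₂, hiv, hv, hvi⟩ := hmem
  haveI := hXint
  haveI := hXnoeth
  obtain ⟨s, hs, hsx, hle, c, m, Φ, hcJ, hc, hdomc, hcb, h𝓢, -, hΦm, hK, hΦc, hΦ𝔪, hΔ⟩ := hvi x hxexcl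
  haveI := hdomc
  -- the stage is proper over `Spec O`
  obtain ⟨-, -, hσ⟩ := chain_isRegular P Y X σ S (hChain _ _ _ hCh) hPnoeth hPreg
  haveI := hσ
  haveI : IsProper (σ ≫ q) := inferInstance
  -- the model square: `j` is a closed immersion onto the special fibre
  haveI : IsClosedImmersion (Spec.map (CommRingCat.ofHom θ)) := IsClosedImmersion.spec_of_surjective _ hθ
  haveI hjci : IsClosedImmersion j := MorphismProperty.IsStableUnderBaseChange.of_isPullback hsq.flip inferInstance
  haveI : IsLocallyNoetherian G := LocallyOfFiniteType.isLocallyNoetherian j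
  have hrangej : Set.range j = (σ ≫ q) ⁻¹' {closedPoint O} := by
    rw [range_eq_preimage_of_isPullback hsq, range_specMap_of_surjective_of_field θ hθ]
  have hjxsp : (σ ≫ q) (j x) = closedPoint O := by
    have h : j x ∈ Set.range j := ⟨x, rfl⟩
    rw [hrangej] at h
    exact h
  have hjxcl : IsClosed ({j x} : Set X) := by
    rw [← Set.image_singleton]; exact hjci.isClosedEmbedding.isClosedMap _ hx
  have hrs : ∀ p' : Spec (.of O), (σ ≫ q) (s p') = p' := fun p' => by
    rw [← Scheme.Hom.comp_apply, hs]; rfl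
  -- the centre `ker s` and the stepped point `j x = s(𝔪_O)`
  obtain ⟨_, -, -, hCsupp⟩ := section_isClosedImmersion_and_isRegular_ker O X (σ ≫ q) s hs
  have hpC : j x ∈ (s.ker.support : Set X) := by rw [hCsupp, ← hsx]; exact ⟨_, rfl⟩
  have hpD : j x ∈ ((𝓢 ⊔ K).support : Set X) := Scheme.IdealSheafData.support_antitone hle hpC
  have hw : ¬ IsGenericPoint (σ (j x)) Y := hiv ⟨j x, hpD, rfl⟩
  -- blow the section up; the model point step (res-D-pv-029, K3″)
  obtain ⟨X₂, τ, hτ⟩ := exists_isBlowup X s.ker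
  obtain ⟨hCh₂, hreg₂, hnoeth₂, hint₂, hdom₂, hG₂int, hT₂irr, hJ, -, -, -, j₂, t₂, hsq₂, hcomm, -, hsets⟩ :=
    modelPointStep_of_section O k θ hθ P q Y hYsp hYirr hYcl Ch hChain hStep X σ S hCh hXreg hdom G j t hsq T hTS x hx hxT
      hTx hw s hs hsx X₂ τ hτ G₂ υ hυ
  haveI := hnoeth₂
  haveI := hG₂int
  haveI hj₂ci : IsClosedImmersion j₂ := MorphismProperty.IsStableUnderBaseChange.of_isPullback hsq₂.flip inferInstance
  haveI : IsLocallyNoetherian G₂ := LocallyOfFiniteType.isLocallyNoetherian j₂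
  have hrangej₂ : Set.range j₂ = ((τ ≫ σ) ≫ q) ⁻¹' {closedPoint O} := by
    rw [range_eq_preimage_of_isPullback hsq₂, range_specMap_of_surjective_of_field θ hθ]
  -- a special point of the centre `V(ker s)` is the stepped point `j x`
  have hsker : ∀ p' : X, (σ ≫ q) p' = closedPoint O → p' ∈ (s.ker.support : Set X) → p' = j x := by
    intro p' hp's hp'C
    rw [hCsupp] at hp'C
    obtain ⟨t', rfl⟩ := hp'C
    have ht' : t' = closedPoint O := by rw [← hrs t']; exact hp's
    rw [ht', hsx]
  -- a uniformizer; the section-frame identities hold for the package frame (same ideal `(ker s)_{j x}`)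
  obtain ⟨ϖ, hϖ⟩ := IsDiscreteValuationRing.exists_irreducible O
  obtain ⟨n', c', -, hc'J, -, -, -, h𝔪', hϖc', -⟩ :=
    exists_sectionFrame_forall_dim_at O (σ ≫ q) s hs (j x) hsx (hXreg (j x)) ϖ hϖ
  have h𝔪 : Ideal.span (Set.range c) ⊔
      Ideal.span {(X.presheaf.Γgerm (j x)).hom ((σ ≫ q).appTop.hom ((Scheme.ΓSpecIso (.of O)).inv.hom ϖ))} =
        maximalIdeal (X.presheaf.stalk (j x)) := by
    rw [hcJ, ← hc'J]; exact h𝔪'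
  have hϖc : (X.presheaf.Γgerm (j x)).hom ((σ ≫ q).appTop.hom ((Scheme.ΓSpecIso (.of O)).inv.hom ϖ)) ∉
      Ideal.span (Set.range c) := by
    rw [hcJ, ← hc'J]; exact hϖc'
  -- `dim 𝒪_{X, j x} = 3 + 1` (T-DIM)
  have hdim : ringKrullDim (X.presheaf.stalk (j x)) = (2 + 2 : ℕ) :=
    ringKrullDim_stalk_eq_succ_of_chain q 3 (hYirr.isGenericPoint_genericPoint hYcl) (hChain _ _ _ hCh) hjxcl hjxsp
  -- supports: `supp (St 𝓢 ⊔ St K) ⊆ τ⁻¹ supp (𝓢 ⊔ K)`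
  have hStsub : ∀ I : X.IdealSheafData,
      ((strictTransformIdeal τ s.ker I).support : Set X₂) ⊆ τ ⁻¹' (I.support : Set X) := fun I =>
    (support_strictTransformIdeal_subset τ s.ker I).trans
      (closure_minimal (Set.preimage_mono fun _ h => h.1) (I.support.isClosed.preimage τ.continuous))
  have hsuppτ : ∀ z ∈ ((strictTransformIdeal τ s.ker 𝓢 ⊔ strictTransformIdeal τ s.ker K).support : Set X₂),
      τ z ∈ ((𝓢 ⊔ K).support : Set X) := by
    intro z hz
    have h1 : τ z ∈ (𝓢.support : Set X) := hStsub 𝓢 (Scheme.IdealSheafData.support_antitone le_sup_left hz)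
    have h2 : τ z ∈ (K.support : Set X) := hStsub K (Scheme.IdealSheafData.support_antitone le_sup_right hz)
    rw [Scheme.IdealSheafData.support_sup, Closeds.coe_inf]
    exact ⟨h1, h2⟩
  -- (iii) regular carrier, locally principal pair: K7d (the carrier is non-zero: `c₀ ≠ 0` by quasi-regularity)
  have hItop : Ideal.span (Set.range c) ≠ ⊤ := fun h =>
    not_subsingleton (X.presheaf.stalk (j x) ⧸ Ideal.span (Set.range c)) (Ideal.Quotient.subsingleton_iff.mpr h)
  have hc0 : c 0 ≠ 0 := by
    intro h0
    have hmem := (isQuasiRegular_def c).mp hc 1 (MvPolynomial.X 0) (MvPolynomial.isHomogeneous_X _ 0)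
      (by rw [MvPolynomial.eval_X, h0]; exact Ideal.zero_mem _) (Finsupp.single 0 1)
    simp only [MvPolynomial.coeff_X, if_true] at hmem
    exact hItop ((Ideal.eq_top_iff_one _).mpr hmem)
  have h𝓢0 : 𝓢 ≠ ⊥ := by
    intro h
    apply hc0
    have h' : stalkIdeal 𝓢 (j x) = ⊥ := by rw [h]; exact stalkIdeal_bot _
    rw [h𝓢, Ideal.span_singleton_eq_bot] at h'
    exact h'
  obtain ⟨⟨hiii₁', hiii₂'⟩, -⟩ :=
    member_clause_iii_strictTransform_section O (σ ≫ q) s hs hXreg hτ 𝓢 K hle h𝓢0 ⟨hiii₁, hiii₂⟩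
  refine ⟨hG₂int, hT₂irr, X₂, τ ≫ σ, closure (τ ⁻¹' (S \ (s.ker.support : Set X))), j₂, t₂,
    strictTransformIdeal τ s.ker 𝓢, strictTransformIdeal τ s.ker K, hCh₂, hint₂, hnoeth₂, hreg₂, hdom₂, hsq₂, hsets,
    ?_, ?_, hiii₁', hiii₂', ?_, ?_, ?_⟩
  · -- (i) exact special fibre: F⁺5 for the cone pack, then K7e downstairs
    rw [comap_strictTransformIdeal_carrierPair_eq_sup_of_conePack O k θ hθ (σ ≫ q) j t hsq s.ker τ hτ υ j₂ hcomm x hx hυ hJ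
        ϖ hϖ c hcJ hc hcb hϖc h𝔪 𝓢 K h𝓢 Φ hΦm hK hΦc hΦ𝔪,
      strictTransformIdeal_comap_sup_eq_vanishingIdeal_of_centredPackage O k θ hθ (σ ≫ q) j t hsq x hx υ hυ ϖ hϖ c hc hcb
        hϖc h𝔪 𝓢 K h𝓢 Φ hΦm hK hΦ𝔪 Z hi]
    congr 1
    exact Closeds.ext closure_closure.symm
  · -- (ii) flat over `O`: K7b with the package frame
    exact flat_carrierStrictTransform_subschemeι_comp_at O σ q s hs τ hτ 𝓢 K hii (j x) hsx c hcJ h𝓢 Φ hΦm hK ϖ hϖ h𝔪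
      hdim hΦ𝔪
  · -- (iv) off the generic point of `Y`
    rintro _ ⟨z, hz, rfl⟩
    rw [Scheme.Hom.comp_apply]
    exact hiv ⟨τ z, hsuppτ z hz, rfl⟩
  · -- (v) regular quotient stalks of codimension two at the special points
    intro z hz hzs hzex
    have hzs' : (σ ≫ q) (τ z) = closedPoint O := by simpa only [Scheme.Hom.comp_apply] using hzs
    by_cases hzp : τ z = j x
    · -- over the stepped point: the Δ-package
      have key := isRegularLocalRing_quotient_carrierStrictTransform_of_coneDeltaRegular_at hτ 𝓢 K (j x) z hzp hpC c hcJ hc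
        hcb h𝓢 Φ hΦm hΦc hK hz hΔ
      exact ⟨key.1, fun _ => key.2⟩
    · -- off the stepped point: `τ` is an isomorphism there and the old member's clause (v) applies
      have hzC : τ z ∉ (s.ker.support : Set X) := by
        rw [hCsupp]
        rintro ⟨p', hp'⟩
        have hp's : p' = closedPoint O := by rw [← hrs p', hp']; exact hzs'
        exact hzp (by rw [← hp', hp's, hsx])
      -- `τ z` is not an excluded point downstairs: else `z ∈ j₂ '' υ⁻¹(excl ∖ {x})`
      have hτz : τ z ∉ j '' excl := by
        rintro ⟨e', he', he'z⟩
        have hzr : z ∈ Set.range j₂ := by rw [hrangej₂]; exact hzs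
        obtain ⟨y₀, rfl⟩ := hzr
        have hυy₀ : υ y₀ = e' := by
          apply hjci.isClosedEmbedding.injective
          rw [← Scheme.Hom.comp_apply, ← hcomm, Scheme.Hom.comp_apply]
          exact he'z.symm
        have hne : e' ≠ x := fun h => hzp (by rw [← he'z, h])
        exact hzex ⟨y₀, ⟨show υ y₀ ∈ excl by rw [hυy₀]; exact he', show υ y₀ ∉ ({x} : Set G) by
          rw [hυy₀]; exact hne⟩, rfl⟩
      obtain ⟨hreg₀, hcod₀⟩ := hv (τ z) (hsuppτ z hz) hzs' hτz
      obtain ⟨hreg₁, hdim₁⟩ := isRegularLocalRing_quotient_carrierStrictTransform_of_not_mem_support hτ 𝓢 K hzC hreg₀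
      refine ⟨hreg₁, fun hzcl => ?_⟩
      haveI : IsProper τ := hτ.isProper
      have hτzcl : IsClosed ({τ z} : Set X) := by rw [← Set.image_singleton]; exact τ.isClosedMap _ hzcl
      rw [hdim₁, ringKrullDim_stalk_eq_of_not_mem_support hτ hzC]
      exact hcod₀ hτzcl
  · -- (vi) the packages at the OTHER excluded points ride along the blow-up (res-D-pv-029, p541005)
    rintro y₀ ⟨hy₀e, hy₀x⟩
    have hp' : j (υ y₀) ∉ (s.ker.support : Set X) := by
      intro h
      have hsp : (σ ≫ q) (j (υ y₀)) = closedPoint O := by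
        have hr : j (υ y₀) ∈ Set.range j := ⟨υ y₀, rfl⟩
        rw [hrangej] at hr
        exact hr
      exact hy₀x (hjci.isClosedEmbedding.injective (hsker _ hsp h))
    have hp'₂ : τ (j₂ y₀) = j (υ y₀) := by
      rw [← Scheme.Hom.comp_apply, hcomm, Scheme.Hom.comp_apply]
    exact centredPackage_strictTransform O P q σ s τ hτ 𝓢 K (j (υ y₀)) hp' (j₂ y₀) hp'₂ (hvi (υ y₀) hy₀e)

end Summit.ResolutionOfSingularities.ResolutionOfSingularities.Cruxes.EquisingularLiftNat.Sections

end
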